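import Summits.QuantumAdvantage.QuantumAdvantage.Theorems.RandomOracleGaugeDecoupledCoreAAL1FamilyTopMass
import Summits.QuantumAdvantage.QuantumAdvantage.Theorems.RandomOracleGaugeDecoupledCoreAAStubDerivativeFamily
import HarnessLib

/-!
# Crux `DecoupledCoreAA` (stmt-QuantumAdvantage-17872) — the crux decl HOLDS in its top-variance regime
# `κ₀ = 0, K₀ ≤ 4` (there `Var q = 1/4`, the decoupled polynomial is Boolean)

A one-block-decoupled `[0,1]`-bounded `q(y,z) = c₀ + Σ_i (±1)^{y_i} g_i(z)` has `Σ_i |g_i(z)| ≤ 1/2` pointwise and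
`Var q = Σ_i E[g_i²] ≤ 1/4` (`stub_derivativeFamily`; `…L1FamilyTopMass.sum_sq_le_one_of_l1` for the doubled family).
So the regime `1 ≤ K₀ · d⁰ · Var q` with `K₀ ≤ 4` forces `Var q = 1/4`: the doubled family `2g` has top mass `1`, is a
signed partition (`…TopMass.signedPartition_of_topMass`), and the Boolean corner (`…BooleanCorner.l1Family_signedPartition`)
yields a variable of `q` with influence `≥ 1/(256 d³)`.

* `decoupledCoreAA_topVariance` — decoupled bounded `q` of degree `≤ d` with `Var q ≥ 1/4` has `∃ j, 1/(256 d³) ≤ Inf_j q`;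
* `decoupledCoreAA_regime_zero` — the body of the crux decl `DecoupledCoreAA` for `κ₀ = 0` and every `0 < K₀ ≤ 4`,
  with `(c, C) = (3, 1/256)`.  The open content of the crux is the regime `K₀ d^κ₀ > 4`.

Honest label: one regime of the crux identified with the Boolean corner; the crux (all regimes) stays open.
Sources: O'Donnell–Zhao arXiv:1512.01603 eqn. (2.1); O'Donnell–Saks–Schramm–Servedio 2005 Thm 1.1.
-/

-- D-0017: single-conjunct summit ⇒ the duplicate `QuantumAdvantage.QuantumAdvantage` is mandated.
set_option linter.dupNamespace false

noncomputable section

open Finset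
open Literature.Computability.QuantumComplexity
open Summit.QuantumAdvantage.QuantumAdvantage.Cruxes.DecoupledCoreAA.L1Family.TopMass (l1Family_topMass)

namespace Summit.QuantumAdvantage.QuantumAdvantage.Cruxes.DecoupledCoreAA.L1Family.TopVariance

/-- **Top-variance decoupled polynomials are governed by the Boolean corner.**  A one-block-decoupled
`[0,1]`-bounded `q` on `Fin (N+N)` of total degree `≤ d` (`d ≥ 1`) with `Var q ≥ 1/4` has a variable of influence
`≥ 1/(256 d³)` (the doubled derivative family `2g_i` is an ℓ¹-family of top mass `4·Var q ≥ 1`).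
[cite: ODonnellZhao2016, eqn. (2.1)] [cite: OdonnellEtAl2005, Thm 1.1] -/
theorem decoupledCoreAA_topVariance {N d : ℕ} (q : MvPolynomial (Fin (N + N)) ℝ)
    (hdec : ∃ (c₀ : ℝ) (g : Fin N → (Fin N → Bool) → ℝ), ∀ (y z : Fin N → Bool),
      evalBool q (Fin.append y z) = c₀ + ∑ i, (if y i then (1 : ℝ) else -1) * g i z)
    (hd : 1 ≤ d) (hdeg : q.totalDegree ≤ d) (hb : ∀ x, 0 ≤ evalBool q x ∧ evalBool q x ≤ 1)
    (hvar : 1 / 4 ≤ boolVariance q) :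
    ∃ j : Fin (N + N), 1 / (256 * (d : ℝ) ^ 3) ≤ influence j q := by
  obtain ⟨c₀, g, hg⟩ := hdec
  obtain ⟨hl1, hinfy, hinfz, hvarq, hpoly⟩ := stub_derivativeFamily N d q c₀ g hg hdeg hb
  choose r hrdeg hrev using hpoly
  -- the doubled family `2 r_i`
  set R : Fin N → MvPolynomial (Fin N) ℝ := fun i => MvPolynomial.C (2 : ℝ) * r i with hR
  have hRev : ∀ i z, evalBool (R i) z = 2 * g i z := by
    intro i z
    rw [hR]
    unfold evalBool
    rw [map_mul, MvPolynomial.eval_C]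
    have := hrev i z
    unfold evalBool at this
    rw [this]
  have hRdeg : ∀ i, (R i).totalDegree ≤ d := by
    intro i
    rw [hR]
    refine (MvPolynomial.totalDegree_mul _ _).trans ?_
    rw [MvPolynomial.totalDegree_C, zero_add]
    exact hrdeg i
  have hRl1 : ∀ z, ∑ i, |evalBool (R i) z| ≤ 1 := by
    intro z
    simp_rw [hRev, abs_mul, abs_two, ← Finset.mul_sum]
    linarith [hl1 z]
  have hRmass : ∀ i, boolAvg (fun z => evalBool (R i) z ^ 2) = 4 * boolAvg (fun z => g i z ^ 2) := by
    intro i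
    simp_rw [hRev]
    unfold boolAvg
    rw [mul_div_assoc', Finset.mul_sum]
    congr 1
    exact Finset.sum_congr rfl fun z _ => by ring
  have hRdiff : ∀ j i, boolAvg (fun z => (evalBool (R i) z - evalBool (R i) (flipBit j z)) ^ 2) =
      4 * boolAvg (fun z => (g i z - g i (flipBit j z)) ^ 2) := by
    intro j i
    simp_rw [hRev]
    unfold boolAvg
    rw [mul_div_assoc', Finset.mul_sum]
    congr 1
    exact Finset.sum_congr rfl fun z _ => by ring
  have hV : 1 ≤ ∑ i, boolAvg (fun z => evalBool (R i) z ^ 2) := by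
    simp_rw [hRmass]
    rw [← Finset.mul_sum, ← hvarq]
    linarith
  rcases l1Family_topMass R hd hRdeg hRl1 hV with ⟨i, hi⟩ | ⟨j, hj⟩
  · refine ⟨Fin.castAdd N i, ?_⟩
    rw [hinfy i, ← hRmass i]
    exact hi
  · refine ⟨Fin.natAdd N j, ?_⟩
    rw [hinfz j]
    simp_rw [hRdiff j] at hj
    rw [← Finset.mul_sum] at hj
    have hd0 : (0 : ℝ) < (d : ℝ) ^ 3 := by
      have : (0 : ℝ) < (d : ℝ) := by exact_mod_cast hd
      positivity
    have h64 : 1 / (64 * (d : ℝ) ^ 3) = 4 * (1 / (256 * (d : ℝ) ^ 3)) := by field_simp; ring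
    rw [h64] at hj
    linarith

/-- **The crux decl `DecoupledCoreAA` HOLDS in the regime `κ₀ = 0`, `0 < K₀ ≤ 4`** (`(c, C) := (3, 1/256)`): its
body, verbatim, with the regime parameters specialised.  The open content of stmt-QuantumAdvantage-17872 is the regime
`K₀ d^κ₀ > 4` (variance below the Boolean ceiling `1/4`). [cite: ODonnellZhao2016, Thm. 2.13]
[cite: OdonnellEtAl2005, Thm 1.1] -/
theorem decoupledCoreAA_regime_zero (K₀ : ℝ) (hK₀ : 0 < K₀) (hK4 : K₀ ≤ 4) :
    ∃ (c : ℕ) (C : ℝ), 0 < C ∧ ∀ (N d : ℕ) (q : MvPolynomial (Fin (N + N)) ℝ),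
      (∃ (c₀ : ℝ) (g : Fin N → (Fin N → Bool) → ℝ), ∀ (y z : Fin N → Bool),
        evalBool q (Fin.append y z) = c₀ + ∑ i, (if y i then (1 : ℝ) else -1) * g i z) →
      1 ≤ d → q.totalDegree ≤ d → (∀ x, 0 ≤ evalBool q x ∧ evalBool q x ≤ 1) →
      1 ≤ K₀ * (d : ℝ) ^ (0 : ℕ) * boolVariance q →
      ∃ j : Fin (N + N), C / (d : ℝ) ^ c ≤ influence j q := by
  refine ⟨3, 1 / 256, by norm_num, ?_⟩
  intro N d q hdec hd hdeg hb hreg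
  have hvar : 1 / 4 ≤ boolVariance q := by
    rw [pow_zero, mul_one] at hreg
    have hV0 := boolVariance_nonneg q
    rw [div_le_iff₀ (by norm_num : (0 : ℝ) < 4)]
    nlinarith
  obtain ⟨j, hj⟩ := decoupledCoreAA_topVariance q hdec hd hdeg hb hvar
  refine ⟨j, le_trans (le_of_eq ?_) hj⟩
  have hd0 : (0 : ℝ) < (d : ℝ) ^ 3 := by
    have : (0 : ℝ) < (d : ℝ) := by exact_mod_cast hd
    positivity
  field_simp

end Summit.QuantumAdvantage.QuantumAdvantage.Cruxes.DecoupledCoreAA.L1Family.TopVariance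

end
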